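import Summits.QuantumFields.BalabanUV.Beta.D1BFx.LocalisedFrameBlocks
import Literature.LinearAlgebra.Matrix.SchurComplementQuotient

/-!
# `BalabanUV.Beta.D1BFx.LocalisedFrameInverse` — road «BF-x» for binder row D1, slot (K), row **(K8-L)(d2-b)(ii) THE BLOCKS OF `𝔅⁻¹`**
# (owner d1-p2-g8 GO, journal 2026-08-21 l.27513 (ii); `K-END-RECUT-SPEC.md` §8): the inverse of the localised frame
# `𝔅 = [[A₀, C],[Cᵀ, Z]]`, `Z = [[c•1, X],[X, 0]]`, block by block — `𝔅⁻¹ = [[S⁻¹, −S⁻¹·(CZ⁻¹)],[−(Z⁻¹Cᵀ)·S⁻¹, Z⁻¹ + (Z⁻¹Cᵀ)·S⁻¹·(CZ⁻¹)]]` with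
# `S` = the `η`-augmented matrix of `ProjectorWeightUnfold` at `M = X⁻¹N`, `CZ⁻¹`, `Z⁻¹Cᵀ`, `Z⁻¹` EXPLICIT in `D, X⁻¹ (= G′), N (= Q′ᵀ), c`, and
# `S⁻¹` in turn explicit in `𝒦_R⁻¹ := (kkt (K + c•D·R·Dᵀ) Q)⁻¹`, `R = 1 − M(MᵀM)⁻¹Mᵀ`; whence the two STRUCTURAL FACTS the owner's CENSUS v3 uses:
# `(𝔅⁻¹)_{(a⊕λ)(a⊕λ)} = 𝒦_R⁻¹` EXACTLY (so `(𝔅⁻¹)_{aa} = Γ_R := (𝒦_R⁻¹)_{aa}`), and the coarse mediation of the `φ`-blocks forced by `(Z⁻¹)_{φφ} = 0`.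

HONEST DEPENDENCY (cell records, verbatim): «continuum YM on T⁴ ⇐ BetaPertH ∧ nine spine estimates (0/9 proved); BetaPertH ⇐ (D1) ∧ (D4) ∧
CAP+tail; G-an2-4 gates asym, D1 and NE2/3/4.»  HONEST FRAMING (cell contract, verbatim): «discharging `BetaPertH` makes Bałaban's UV stability
UNCONDITIONAL — a real constructive-QFT result; it is NOT the continuum limit and NOT the Clay problem.»  THIS MODULE DISCHARGES NOTHING of (K),
of D1 or of the wall: [folklore] finite-dimensional linear algebra (Mathlib's block inverse `Matrix.invOf_fromBlocks₂₂_eq`, block products) over the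
tree's `Beta.Composition.kkt`, `ProjectorWeightUnfold` (p249004), `ResolventWeightUnfold` (p249228) and `LocalisedFrameBlocks` (p249599) BY NAME.
The leading-UV READINGS of the blocks (CENSUS v3) are the owner's and are NOT asserted here.  No definition, no `def … : Prop`, nothing cited, no
wall binder instantiated, 0 sorry.  NOT D1, NOT BetaPertH, NOT continuum, NOT Clay.

ABSOLUTE RULE (cell charter, verbatim): «No internally-minted statement may enter as a cited fact. Every hypothesis is either kernel-proved in this
package or a verbatim quotation of a PUBLISHED theorem with page reference. The manuscript(s) under audit are NOT citable for their own disputed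
steps — they are the thing under adjudication; programme-internal (2001/route/tribunal) claims are never citable.»

CONTENT (field `𝕜`; `ν` fields `a`, `μ` constraints `λ_Q`, `σ` gauge parameters, `m` blocks; `K : ν×ν`, `Q : μ×ν`, `D : ν×σ`, `X : σ×σ`, `N : σ×m`, `c : 𝕜`;
index order `((a ⊕ λ_Q) ⊕ η) ⊕ (φ ⊕ ψ)`; every letter SPELLED OUT, no abbreviation defined — in the docstrings: `A₀ := [[kkt (K + c•DDᵀ) Q, 0],[0, 0_m]]`,
`C := [[−c•D ⊕ 0, 0],[0, −Nᵀ]]`, `Z := [[c•1, X],[X, 0]]`, `Z⁻¹ = [[0, X⁻¹],[X⁻¹, −c•X⁻¹X⁻¹]]` (p249228 `zaux_inv`), `S := aug(M) = [[kkt (K + c•DDᵀ) Q,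
[−c•DM; 0]],[[−c•MᵀDᵀ, 0], c•MᵀM]]` at `M = X⁻¹N`, `𝒦_R := kkt (K + c•D(1 − M(MᵀM)⁻¹Mᵀ)Dᵀ) Q`):
* §0 [folklore] `inv_fromBlocks₂₂_of_isUnit_det` — Mathlib's `invOf_fromBlocks₂₂_eq` with nonsingular inverses (generic).
* §1 [folklore] the couplings through `Z⁻¹`: `couplings_mul_zauxInv : C·Z⁻¹ = [[0, −c•DX⁻¹ ⊕ 0],[−NᵀX⁻¹, c•NᵀX⁻¹X⁻¹]]`, `zauxInv_mul_couplingsT :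
  Z⁻¹·Cᵀ = [[0, −X⁻¹N],[−c•X⁻¹Dᵀ | 0, c•X⁻¹X⁻¹N]]`, `frame_schur : A₀ − C·Z⁻¹·Cᵀ =` (p249599's `schur_eq` right side), `frame_schur_aug` (`Xᵀ = X`: `= S`).
* §2 [folklore] **`inv_frame`** (`Xᵀ = X`, `det X` a unit, `det S` a unit; NO `c ≠ 0`): `𝔅⁻¹` as the displayed block matrix in `S⁻¹`, `X⁻¹`, `D`, `N`, `c`.
* §3 [folklore] `kkt_sub_corner`, `schurAug_eq_kkt` (the Schur complement of `S`'s `η`-block is `𝒦_R` — p249004's computation as a MATRIX identity),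
  **`inv_aug`** (`c ≠ 0`, `det(MᵀM)`, `det 𝒦_R` units): `S⁻¹ = [[𝒦_R⁻¹, 𝒦_R⁻¹[DM(MᵀM)⁻¹; 0]],[[(MᵀM)⁻¹MᵀDᵀ | 0]𝒦_R⁻¹, c⁻¹•(MᵀM)⁻¹ + […]𝒦_R⁻¹[…]]]`.
* §4 [folklore] STRUCTURAL FACTS: **`inv_frame_toBlocks₁₁_toBlocks₁₁ : (𝔅⁻¹)_{(a⊕λ)(a⊕λ)} = 𝒦_R⁻¹`** and `inv_frame_aa : (𝔅⁻¹)_{aa} = (𝒦_R⁻¹)_{aa}` (= `Γ_R`,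
  EXACT — the owner's kit j120171∕2 `|(𝔅⁻¹)_{aa} − Γ_R|_max ≤ 1.5e-13` is this identity), `inv_frame_lamlam : (𝔅⁻¹)_{λλ} = −(Q·H_R⁻¹·Qᵀ)⁻¹`,
  `H_R = K + c•D·R·Dᵀ` (the coarse `λ`-line of an3-g51's needle-row count, by name); **`inv_frame_φφ : (𝔅⁻¹)_{φφ} = (X⁻¹N)·(S⁻¹)_{ηη}·(NᵀX⁻¹)`** and
  `inv_frame_aφ : (𝔅⁻¹)_{(a⊕λ),φ} = (S⁻¹)_{(a⊕λ),η}·(NᵀX⁻¹)` — because `(Z⁻¹)_{φφ} = 0` and `C` couples `φ` only to `a`, every `φ`-leg of `𝔅⁻¹` passes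
  through the block variable `η` («coarse-mediated»); with §3, `(S⁻¹)_{(a⊕λ),η}·Mᵀ = 𝒦_R⁻¹·[D·M(MᵀM)⁻¹Mᵀ; 0]` (the projector onto `range M`).
Unit `b2b-balaban-beta-d1-formalise-leaf-03` (gen 10); road owner `b2b-balaban-beta-d1-p2` (GO l.27513 (ii)); sequel of p249599.
-/

namespace Summit.QuantumFields.BalabanUV.Beta.D1BFx.LocalisedFrameInverse

open Matrix
open Literature.MathematicalPhysics.QuantumFieldTheory.Balaban1983to89.Beta.Composition (kkt det_kkt_ne_zero)
open Literature.LinearAlgebra.Matrix (toBlocks₂₂_inv_fromBlocks schurCompl_def)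
open Summit.QuantumFields.BalabanUV.Beta.D1BFx.ProjectorWeightUnfold (weight_unfold det_aug_eq_det_gram_mul_det_kkt)
open Summit.QuantumFields.BalabanUV.Beta.D1BFx.ResolventWeightUnfold (zaux_inv isUnit_det_zaux)
open Summit.QuantumFields.BalabanUV.Beta.D1BFx.LocalisedFrameBlocks (frame_eq_fromBlocks schur_eq schur_eq_aug)

section Field

variable {𝕜 : Type*} [Field 𝕜]

/-! ## §0 Block inverse around an invertible bottom-right block (generic) -/

section Generic

variable {l n : Type*} [Fintype l] [Fintype n] [DecidableEq l] [DecidableEq n]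

/-- [folklore] **BLOCK INVERSE (Banachiewicz), bottom-right pivot**: if `D` and the Schur complement `S = A − B·D⁻¹·C` are nonsingular then
`[[A, B],[C, D]]⁻¹ = [[S⁻¹, −S⁻¹·(BD⁻¹)],[−(D⁻¹C)·S⁻¹, D⁻¹ + (D⁻¹C)·S⁻¹·(BD⁻¹)]]` (Mathlib's `Matrix.invOf_fromBlocks₂₂_eq`, restated with nonsingular
inverses; the tree's `Literature.LinearAlgebra.Matrix.inv_fromBlocks_of_isUnit_det` is the top-left-pivot twin). -/
theorem inv_fromBlocks₂₂_of_isUnit_det (A : Matrix l l 𝕜) (B : Matrix l n 𝕜) (C : Matrix n l 𝕜) (D : Matrix n n 𝕜)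
    (hD : IsUnit D.det) (hS : IsUnit (A - B * D⁻¹ * C).det) :
    (fromBlocks A B C D)⁻¹ =
      fromBlocks (A - B * D⁻¹ * C)⁻¹ (-((A - B * D⁻¹ * C)⁻¹ * (B * D⁻¹))) (-((D⁻¹ * C) * (A - B * D⁻¹ * C)⁻¹))
        (D⁻¹ + (D⁻¹ * C) * (A - B * D⁻¹ * C)⁻¹ * (B * D⁻¹)) := by
  letI := invertibleOfIsUnitDet D hD
  have hS' : IsUnit (A - B * ⅟D * C).det := by rwa [invOf_eq_nonsing_inv]
  letI := invertibleOfIsUnitDet _ hS'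
  letI := fromBlocks₂₂Invertible A B C D
  rw [← invOf_eq_nonsing_inv (fromBlocks A B C D), invOf_fromBlocks₂₂_eq]
  simp only [invOf_eq_nonsing_inv, Matrix.mul_assoc]

end Generic

section Frame

variable {ν μ σ m : Type*} [Fintype ν] [Fintype μ] [Fintype σ] [Fintype m] [DecidableEq ν] [DecidableEq μ] [DecidableEq σ] [DecidableEq m]

/-! ## §1 The couplings through `Z⁻¹` and the Schur complement -/

omit [Fintype ν] [Fintype μ] [Fintype m] [DecidableEq ν] [DecidableEq μ] [DecidableEq m] in
/-- [folklore] `C·Z⁻¹ = [[0, −c•DX⁻¹ ⊕ 0],[−NᵀX⁻¹, c•NᵀX⁻¹X⁻¹]]` (rows `(a ⊕ λ_Q) ⊕ η`, columns `φ ⊕ ψ`): the field `a` meets only `ψ`, through `−c•DX⁻¹`. -/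
theorem couplings_mul_zauxInv (D : Matrix ν σ 𝕜) (X : Matrix σ σ 𝕜) (N : Matrix σ m 𝕜) (c : 𝕜) :
    fromBlocks (fromRows (-(c • D)) (0 : Matrix μ σ 𝕜)) (0 : Matrix (ν ⊕ μ) σ 𝕜) (0 : Matrix m σ 𝕜) (-Nᵀ)
        * fromBlocks (0 : Matrix σ σ 𝕜) X⁻¹ X⁻¹ (-(c • (X⁻¹ * X⁻¹)))
      = fromBlocks (0 : Matrix (ν ⊕ μ) σ 𝕜) (fromRows (-(c • (D * X⁻¹))) (0 : Matrix μ σ 𝕜)) (-(Nᵀ * X⁻¹))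
          (c • (Nᵀ * X⁻¹ * X⁻¹)) := by
  rw [fromBlocks_multiply]
  simp only [Matrix.mul_zero, Matrix.zero_mul, zero_add, add_zero, fromRows_mul, Matrix.neg_mul, Matrix.mul_neg, neg_neg,
    Matrix.smul_mul, Matrix.mul_smul, smul_zero, neg_zero, smul_neg, Matrix.mul_assoc]

omit [Fintype ν] [Fintype μ] [Fintype m] [DecidableEq ν] [DecidableEq μ] [DecidableEq m] in
/-- [folklore] `Z⁻¹·Cᵀ = [[0, −X⁻¹N],[−c•X⁻¹Dᵀ | 0, c•X⁻¹X⁻¹N]]` (rows `φ ⊕ ψ`, columns `(a ⊕ λ_Q) ⊕ η`). -/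
theorem zauxInv_mul_couplingsT (D : Matrix ν σ 𝕜) (X : Matrix σ σ 𝕜) (N : Matrix σ m 𝕜) (c : 𝕜) :
    fromBlocks (0 : Matrix σ σ 𝕜) X⁻¹ X⁻¹ (-(c • (X⁻¹ * X⁻¹)))
        * fromBlocks (fromCols (-(c • Dᵀ)) (0 : Matrix σ μ 𝕜)) (0 : Matrix σ m 𝕜) (0 : Matrix σ (ν ⊕ μ) 𝕜) (-N)
      = fromBlocks (0 : Matrix σ (ν ⊕ μ) 𝕜) (-(X⁻¹ * N)) (fromCols (-(c • (X⁻¹ * Dᵀ))) (0 : Matrix σ μ 𝕜))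
          (c • (X⁻¹ * X⁻¹ * N)) := by
  rw [fromBlocks_multiply]
  simp only [Matrix.mul_zero, Matrix.zero_mul, zero_add, add_zero, mul_fromCols, Matrix.neg_mul, Matrix.mul_neg, neg_neg,
    Matrix.smul_mul, Matrix.mul_smul, Matrix.mul_assoc]

omit [Fintype ν] [Fintype μ] [Fintype m] [DecidableEq ν] [DecidableEq μ] [DecidableEq m] in
/-- [folklore] **`A₀ − C·Z⁻¹·Cᵀ`** (with `Z⁻¹` explicit) = `[[kkt (K + c•DDᵀ) Q, [−c•D(X⁻¹N); 0]], [[−c•NᵀX⁻¹Dᵀ, 0], c•NᵀX⁻¹(X⁻¹N)]]` = the right side of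
`LocalisedFrameBlocks.schur_eq` (symmetry of `X` not used). -/
theorem frame_schur (K : Matrix ν ν 𝕜) (Q : Matrix μ ν 𝕜) (D : Matrix ν σ 𝕜) (X : Matrix σ σ 𝕜) (N : Matrix σ m 𝕜) (c : 𝕜) :
    fromBlocks (kkt (K + c • (D * Dᵀ)) Q) (0 : Matrix (ν ⊕ μ) m 𝕜) (0 : Matrix m (ν ⊕ μ) 𝕜) (0 : Matrix m m 𝕜)
        - fromBlocks (fromRows (-(c • D)) (0 : Matrix μ σ 𝕜)) (0 : Matrix (ν ⊕ μ) σ 𝕜) (0 : Matrix m σ 𝕜) (-Nᵀ)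
            * fromBlocks (0 : Matrix σ σ 𝕜) X⁻¹ X⁻¹ (-(c • (X⁻¹ * X⁻¹)))
            * fromBlocks (fromCols (-(c • Dᵀ)) (0 : Matrix σ μ 𝕜)) (0 : Matrix σ m 𝕜) (0 : Matrix σ (ν ⊕ μ) 𝕜) (-N)
      = fromBlocks (kkt (K + c • (D * Dᵀ)) Q) (fromRows (-(c • (D * (X⁻¹ * N)))) (0 : Matrix μ m 𝕜))
          (fromCols (-(c • (Nᵀ * X⁻¹ * Dᵀ))) (0 : Matrix m μ 𝕜)) (c • (Nᵀ * X⁻¹ * (X⁻¹ * N))) := by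
  rw [couplings_mul_zauxInv, fromBlocks_multiply]
  simp only [Matrix.mul_zero, Matrix.zero_mul, zero_add, add_zero, fromRows_mul, mul_fromCols, Matrix.neg_mul, Matrix.mul_neg,
    Matrix.smul_mul, Matrix.mul_smul]
  rw [sub_eq_add_neg, fromBlocks_neg, fromBlocks_add]
  simp only [neg_zero, add_zero, zero_add, fromRows_neg, fromCols_neg, neg_neg, Matrix.mul_assoc]

omit [Fintype ν] [Fintype μ] [Fintype m] [DecidableEq ν] [DecidableEq μ] [DecidableEq m] in
/-- [folklore] … and for `X` symmetric it is `S` = `ProjectorWeightUnfold`'s `η`-augmented matrix at `M := X⁻¹N` (via p249599's `schur_eq`∕`schur_eq_aug`). -/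
theorem frame_schur_aug (K : Matrix ν ν 𝕜) (Q : Matrix μ ν 𝕜) (D : Matrix ν σ 𝕜) {X : Matrix σ σ 𝕜} (hX : Xᵀ = X)
    (N : Matrix σ m 𝕜) (c : 𝕜) :
    fromBlocks (kkt (K + c • (D * Dᵀ)) Q) (0 : Matrix (ν ⊕ μ) m 𝕜) (0 : Matrix m (ν ⊕ μ) 𝕜) (0 : Matrix m m 𝕜)
        - fromBlocks (fromRows (-(c • D)) (0 : Matrix μ σ 𝕜)) (0 : Matrix (ν ⊕ μ) σ 𝕜) (0 : Matrix m σ 𝕜) (-Nᵀ)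
            * fromBlocks (0 : Matrix σ σ 𝕜) X⁻¹ X⁻¹ (-(c • (X⁻¹ * X⁻¹)))
            * fromBlocks (fromCols (-(c • Dᵀ)) (0 : Matrix σ μ 𝕜)) (0 : Matrix σ m 𝕜) (0 : Matrix σ (ν ⊕ μ) 𝕜) (-N)
      = fromBlocks (kkt (K + c • (D * Dᵀ)) Q) (fromRows (-(c • (D * (X⁻¹ * N)))) (0 : Matrix μ m 𝕜))
          (fromCols (-(c • ((X⁻¹ * N)ᵀ * Dᵀ))) (0 : Matrix m μ 𝕜)) (c • ((X⁻¹ * N)ᵀ * (X⁻¹ * N))) := by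
  rw [frame_schur, ← schur_eq K Q D X N c]
  exact schur_eq_aug K Q D hX N c

/-! ## §2 `𝔅⁻¹` block by block -/

/-- [folklore] **THE INVERSE OF THE LOCALISED FRAME**: for `X` symmetric with `det X` a unit and `det S` a unit (`S` = the `η`-augmented matrix at
`M = X⁻¹N`; NO `c ≠ 0` needed), `𝔅⁻¹ = [[S⁻¹, −S⁻¹·(CZ⁻¹)],[−(Z⁻¹Cᵀ)·S⁻¹, Z⁻¹ + (Z⁻¹Cᵀ)·S⁻¹·(CZ⁻¹)]]` with `CZ⁻¹ = [[0, −c•DX⁻¹ ⊕ 0],[−NᵀX⁻¹,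
c•NᵀX⁻¹X⁻¹]]`, `Z⁻¹Cᵀ = [[0, −X⁻¹N],[−c•X⁻¹Dᵀ | 0, c•X⁻¹X⁻¹N]]`, `Z⁻¹ = [[0, X⁻¹],[X⁻¹, −c•X⁻¹X⁻¹]]` — every block explicit in `S⁻¹, X⁻¹, D, N, c`. -/
theorem inv_frame (K : Matrix ν ν 𝕜) (Q : Matrix μ ν 𝕜) (D : Matrix ν σ 𝕜) {X : Matrix σ σ 𝕜} (hX : Xᵀ = X) (hXu : IsUnit X.det)
    (N : Matrix σ m 𝕜) (c : 𝕜)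
    (hS : IsUnit (fromBlocks (kkt (K + c • (D * Dᵀ)) Q) (fromRows (-(c • (D * (X⁻¹ * N)))) (0 : Matrix μ m 𝕜))
      (fromCols (-(c • ((X⁻¹ * N)ᵀ * Dᵀ))) (0 : Matrix m μ 𝕜)) (c • ((X⁻¹ * N)ᵀ * (X⁻¹ * N)))).det) :
    (fromBlocks
        (fromBlocks (kkt (K + c • (D * Dᵀ)) Q) (0 : Matrix (ν ⊕ μ) m 𝕜) (0 : Matrix m (ν ⊕ μ) 𝕜) (0 : Matrix m m 𝕜))
        (fromCols (fromRows (fromRows (-(c • D)) (0 : Matrix μ σ 𝕜)) (0 : Matrix m σ 𝕜))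
          (fromRows (fromRows (0 : Matrix ν σ 𝕜) (0 : Matrix μ σ 𝕜)) (-Nᵀ)))
        (fromRows (fromRows (fromRows (-(c • D)) (0 : Matrix μ σ 𝕜)) (0 : Matrix m σ 𝕜))ᵀ
          (fromRows (fromRows (0 : Matrix ν σ 𝕜) (0 : Matrix μ σ 𝕜)) (-Nᵀ))ᵀ)
        (fromBlocks (c • (1 : Matrix σ σ 𝕜)) X X 0))⁻¹
      = fromBlocks
        (fromBlocks (kkt (K + c • (D * Dᵀ)) Q) (fromRows (-(c • (D * (X⁻¹ * N)))) (0 : Matrix μ m 𝕜))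
          (fromCols (-(c • ((X⁻¹ * N)ᵀ * Dᵀ))) (0 : Matrix m μ 𝕜)) (c • ((X⁻¹ * N)ᵀ * (X⁻¹ * N))))⁻¹
        (-((fromBlocks (kkt (K + c • (D * Dᵀ)) Q) (fromRows (-(c • (D * (X⁻¹ * N)))) (0 : Matrix μ m 𝕜))
              (fromCols (-(c • ((X⁻¹ * N)ᵀ * Dᵀ))) (0 : Matrix m μ 𝕜)) (c • ((X⁻¹ * N)ᵀ * (X⁻¹ * N))))⁻¹
            * fromBlocks (0 : Matrix (ν ⊕ μ) σ 𝕜) (fromRows (-(c • (D * X⁻¹))) (0 : Matrix μ σ 𝕜)) (-(Nᵀ * X⁻¹))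
                (c • (Nᵀ * X⁻¹ * X⁻¹))))
        (-(fromBlocks (0 : Matrix σ (ν ⊕ μ) 𝕜) (-(X⁻¹ * N)) (fromCols (-(c • (X⁻¹ * Dᵀ))) (0 : Matrix σ μ 𝕜))
              (c • (X⁻¹ * X⁻¹ * N))
            * (fromBlocks (kkt (K + c • (D * Dᵀ)) Q) (fromRows (-(c • (D * (X⁻¹ * N)))) (0 : Matrix μ m 𝕜))
                (fromCols (-(c • ((X⁻¹ * N)ᵀ * Dᵀ))) (0 : Matrix m μ 𝕜)) (c • ((X⁻¹ * N)ᵀ * (X⁻¹ * N))))⁻¹))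
        (fromBlocks (0 : Matrix σ σ 𝕜) X⁻¹ X⁻¹ (-(c • (X⁻¹ * X⁻¹)))
          + fromBlocks (0 : Matrix σ (ν ⊕ μ) 𝕜) (-(X⁻¹ * N)) (fromCols (-(c • (X⁻¹ * Dᵀ))) (0 : Matrix σ μ 𝕜))
              (c • (X⁻¹ * X⁻¹ * N))
            * (fromBlocks (kkt (K + c • (D * Dᵀ)) Q) (fromRows (-(c • (D * (X⁻¹ * N)))) (0 : Matrix μ m 𝕜))
                (fromCols (-(c • ((X⁻¹ * N)ᵀ * Dᵀ))) (0 : Matrix m μ 𝕜)) (c • ((X⁻¹ * N)ᵀ * (X⁻¹ * N))))⁻¹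
            * fromBlocks (0 : Matrix (ν ⊕ μ) σ 𝕜) (fromRows (-(c • (D * X⁻¹))) (0 : Matrix μ σ 𝕜)) (-(Nᵀ * X⁻¹))
                (c • (Nᵀ * X⁻¹ * X⁻¹))) := by
  have hZ : IsUnit (fromBlocks (c • (1 : Matrix σ σ 𝕜)) X X 0).det := isUnit_det_zaux c hXu
  have hSch : fromBlocks (kkt (K + c • (D * Dᵀ)) Q) (0 : Matrix (ν ⊕ μ) m 𝕜) (0 : Matrix m (ν ⊕ μ) 𝕜) (0 : Matrix m m 𝕜)
        - fromBlocks (fromRows (-(c • D)) (0 : Matrix μ σ 𝕜)) (0 : Matrix (ν ⊕ μ) σ 𝕜) (0 : Matrix m σ 𝕜) (-Nᵀ)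
            * (fromBlocks (c • (1 : Matrix σ σ 𝕜)) X X 0)⁻¹
            * fromBlocks (fromCols (-(c • Dᵀ)) (0 : Matrix σ μ 𝕜)) (0 : Matrix σ m 𝕜) (0 : Matrix σ (ν ⊕ μ) 𝕜) (-N)
      = fromBlocks (kkt (K + c • (D * Dᵀ)) Q) (fromRows (-(c • (D * (X⁻¹ * N)))) (0 : Matrix μ m 𝕜))
          (fromCols (-(c • ((X⁻¹ * N)ᵀ * Dᵀ))) (0 : Matrix m μ 𝕜)) (c • ((X⁻¹ * N)ᵀ * (X⁻¹ * N))) := by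
    rw [zaux_inv c hXu, frame_schur_aug K Q D hX N c]
  have hS' := hS
  rw [← hSch] at hS'
  rw [frame_eq_fromBlocks, inv_fromBlocks₂₂_of_isUnit_det _ _ _ _ hZ hS', hSch, zaux_inv c hXu, couplings_mul_zauxInv,
    zauxInv_mul_couplingsT]

/-! ## §3 `S⁻¹` through `𝒦_R⁻¹` -/

omit [Fintype ν] [Fintype μ] [Fintype σ] [Fintype m] [DecidableEq ν] [DecidableEq μ] [DecidableEq σ] [DecidableEq m] in
/-- [folklore] Subtracting a top-left corner from a bordered matrix: `kkt A Q − [[W, 0],[0, 0]] = kkt (A − W) Q`. -/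
theorem kkt_sub_corner (A W : Matrix ν ν 𝕜) (Q : Matrix μ ν 𝕜) :
    kkt A Q - fromBlocks W (0 : Matrix ν μ 𝕜) (0 : Matrix μ ν 𝕜) (0 : Matrix μ μ 𝕜) = kkt (A - W) Q := by
  unfold kkt
  rw [sub_eq_add_neg, fromBlocks_neg, fromBlocks_add, sub_eq_add_neg]
  simp only [neg_zero, add_zero]

omit [Fintype ν] [Fintype μ] [DecidableEq ν] [DecidableEq μ] in
/-- [folklore] **THE SCHUR COMPLEMENT OF `S`'s `η`-BLOCK IS `𝒦_R`** (the computation inside p249004's `det_aug_eq_det_gram_mul_det_kkt`, as a matrix identity):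
for `c ≠ 0` and `det(MᵀM)` a unit, `kkt (K + c•DDᵀ) Q − [−c•DM; 0]·(c•MᵀM)⁻¹·[−c•MᵀDᵀ | 0] = kkt (K + c•D(1 − M(MᵀM)⁻¹Mᵀ)Dᵀ) Q`. -/
theorem schurAug_eq_kkt (K : Matrix ν ν 𝕜) (Q : Matrix μ ν 𝕜) (D : Matrix ν σ 𝕜) (M : Matrix σ m 𝕜) {c : 𝕜} (hc : c ≠ 0)
    (hM : IsUnit (Mᵀ * M).det) :
    kkt (K + c • (D * Dᵀ)) Q - fromRows (-(c • (D * M))) (0 : Matrix μ m 𝕜) * (c • (Mᵀ * M))⁻¹ * fromCols (-(c • (Mᵀ * Dᵀ))) (0 : Matrix m μ 𝕜)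
      = kkt (K + c • (D * (1 - M * (Mᵀ * M)⁻¹ * Mᵀ) * Dᵀ)) Q := by
  have hinv : (c • (Mᵀ * M))⁻¹ = c⁻¹ • (Mᵀ * M)⁻¹ := by
    apply Matrix.inv_eq_left_inv
    rw [Matrix.smul_mul, Matrix.mul_smul, smul_smul, nonsing_inv_mul _ hM, inv_mul_cancel₀ hc, one_smul]
  have e : fromRows (-(c • (D * M))) (0 : Matrix μ m 𝕜) * (c • (Mᵀ * M))⁻¹ * fromCols (-(c • (Mᵀ * Dᵀ))) (0 : Matrix m μ 𝕜)
      = fromBlocks (c • (D * M * (Mᵀ * M)⁻¹ * Mᵀ * Dᵀ)) 0 0 (0 : Matrix μ μ 𝕜) := by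
    rw [fromRows_mul, fromRows_mul_fromCols, hinv]
    simp only [Matrix.zero_mul, Matrix.mul_zero, Matrix.neg_mul, Matrix.mul_neg, Matrix.smul_mul, Matrix.mul_smul, smul_smul]
    rw [mul_inv_cancel₀ hc]
    simp only [one_smul, neg_neg, neg_zero, Matrix.mul_assoc]
  rw [e, kkt_sub_corner, weight_unfold, smul_sub, add_sub_assoc]

/-- [folklore] **`S⁻¹` BLOCK BY BLOCK THROUGH `𝒦_R⁻¹`**: for `c ≠ 0`, `det(MᵀM)` and `det 𝒦_R` units (`𝒦_R := kkt (K + c•D(1 − M(MᵀM)⁻¹Mᵀ)Dᵀ) Q`),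
`S⁻¹ = [[𝒦_R⁻¹, 𝒦_R⁻¹·[DM(MᵀM)⁻¹; 0]], [[(MᵀM)⁻¹MᵀDᵀ | 0]·𝒦_R⁻¹, c⁻¹•(MᵀM)⁻¹ + [(MᵀM)⁻¹MᵀDᵀ | 0]·𝒦_R⁻¹·[DM(MᵀM)⁻¹; 0]]]` — in particular
`(S⁻¹)_{(a⊕λ)(a⊕λ)} = 𝒦_R⁻¹` and `(S⁻¹)_{(a⊕λ),η}·Mᵀ = 𝒦_R⁻¹·[D·M(MᵀM)⁻¹Mᵀ; 0]` (the projector onto `range M`). -/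
theorem inv_aug (K : Matrix ν ν 𝕜) (Q : Matrix μ ν 𝕜) (D : Matrix ν σ 𝕜) (M : Matrix σ m 𝕜) {c : 𝕜} (hc : c ≠ 0)
    (hM : IsUnit (Mᵀ * M).det) (h𝒦 : IsUnit (kkt (K + c • (D * (1 - M * (Mᵀ * M)⁻¹ * Mᵀ) * Dᵀ)) Q).det) :
    (fromBlocks (kkt (K + c • (D * Dᵀ)) Q) (fromRows (-(c • (D * M))) (0 : Matrix μ m 𝕜))
        (fromCols (-(c • (Mᵀ * Dᵀ))) (0 : Matrix m μ 𝕜)) (c • (Mᵀ * M)))⁻¹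
      = fromBlocks (kkt (K + c • (D * (1 - M * (Mᵀ * M)⁻¹ * Mᵀ) * Dᵀ)) Q)⁻¹
          ((kkt (K + c • (D * (1 - M * (Mᵀ * M)⁻¹ * Mᵀ) * Dᵀ)) Q)⁻¹ * fromRows (D * M * (Mᵀ * M)⁻¹) (0 : Matrix μ m 𝕜))
          (fromCols ((Mᵀ * M)⁻¹ * Mᵀ * Dᵀ) (0 : Matrix m μ 𝕜) * (kkt (K + c • (D * (1 - M * (Mᵀ * M)⁻¹ * Mᵀ) * Dᵀ)) Q)⁻¹)
          (c⁻¹ • (Mᵀ * M)⁻¹ + fromCols ((Mᵀ * M)⁻¹ * Mᵀ * Dᵀ) (0 : Matrix m μ 𝕜)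
              * (kkt (K + c • (D * (1 - M * (Mᵀ * M)⁻¹ * Mᵀ) * Dᵀ)) Q)⁻¹ * fromRows (D * M * (Mᵀ * M)⁻¹) (0 : Matrix μ m 𝕜)) := by
  have hcu : IsUnit c := isUnit_iff_ne_zero.mpr hc
  have hW : IsUnit (c • (Mᵀ * M)).det := by
    rw [det_smul]; exact (hcu.pow _).mul hM
  have hinv : (c • (Mᵀ * M))⁻¹ = c⁻¹ • (Mᵀ * M)⁻¹ := by
    apply Matrix.inv_eq_left_inv
    rw [Matrix.smul_mul, Matrix.mul_smul, smul_smul, nonsing_inv_mul _ hM, inv_mul_cancel₀ hc, one_smul]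
  have hBW : fromRows (-(c • (D * M))) (0 : Matrix μ m 𝕜) * (c • (Mᵀ * M))⁻¹ = -fromRows (D * M * (Mᵀ * M)⁻¹) (0 : Matrix μ m 𝕜) := by
    rw [hinv, fromRows_mul, fromRows_neg, Matrix.zero_mul, neg_zero, Matrix.neg_mul, Matrix.smul_mul, Matrix.mul_smul, smul_smul,
      mul_inv_cancel₀ hc, one_smul, Matrix.mul_assoc]
  have hWB : (c • (Mᵀ * M))⁻¹ * fromCols (-(c • (Mᵀ * Dᵀ))) (0 : Matrix m μ 𝕜) = -fromCols ((Mᵀ * M)⁻¹ * Mᵀ * Dᵀ) (0 : Matrix m μ 𝕜) := by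
    rw [hinv, mul_fromCols, fromCols_neg, Matrix.mul_zero, neg_zero, Matrix.mul_neg, Matrix.smul_mul, Matrix.mul_smul, smul_smul,
      inv_mul_cancel₀ hc, one_smul, Matrix.mul_assoc]
  have hSch := schurAug_eq_kkt K Q D M hc hM
  have hS' := h𝒦
  rw [← hSch] at hS'
  rw [inv_fromBlocks₂₂_of_isUnit_det _ _ _ _ hW hS', hSch, hBW, hWB, hinv]
  simp only [Matrix.mul_neg, Matrix.neg_mul, neg_neg]

/-! ## §4 The structural facts used by CENSUS v3 -/

/-- [folklore] `(𝔅⁻¹)_{((a⊕λ)⊕η),((a⊕λ)⊕η)} = S⁻¹`. -/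
theorem inv_frame_toBlocks₁₁ (K : Matrix ν ν 𝕜) (Q : Matrix μ ν 𝕜) (D : Matrix ν σ 𝕜) {X : Matrix σ σ 𝕜} (hX : Xᵀ = X)
    (hXu : IsUnit X.det) (N : Matrix σ m 𝕜) (c : 𝕜)
    (hS : IsUnit (fromBlocks (kkt (K + c • (D * Dᵀ)) Q) (fromRows (-(c • (D * (X⁻¹ * N)))) (0 : Matrix μ m 𝕜))
      (fromCols (-(c • ((X⁻¹ * N)ᵀ * Dᵀ))) (0 : Matrix m μ 𝕜)) (c • ((X⁻¹ * N)ᵀ * (X⁻¹ * N)))).det) :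
    ((fromBlocks
        (fromBlocks (kkt (K + c • (D * Dᵀ)) Q) (0 : Matrix (ν ⊕ μ) m 𝕜) (0 : Matrix m (ν ⊕ μ) 𝕜) (0 : Matrix m m 𝕜))
        (fromCols (fromRows (fromRows (-(c • D)) (0 : Matrix μ σ 𝕜)) (0 : Matrix m σ 𝕜))
          (fromRows (fromRows (0 : Matrix ν σ 𝕜) (0 : Matrix μ σ 𝕜)) (-Nᵀ)))
        (fromRows (fromRows (fromRows (-(c • D)) (0 : Matrix μ σ 𝕜)) (0 : Matrix m σ 𝕜))ᵀ
          (fromRows (fromRows (0 : Matrix ν σ 𝕜) (0 : Matrix μ σ 𝕜)) (-Nᵀ))ᵀ)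
        (fromBlocks (c • (1 : Matrix σ σ 𝕜)) X X 0))⁻¹).toBlocks₁₁
      = (fromBlocks (kkt (K + c • (D * Dᵀ)) Q) (fromRows (-(c • (D * (X⁻¹ * N)))) (0 : Matrix μ m 𝕜))
          (fromCols (-(c • ((X⁻¹ * N)ᵀ * Dᵀ))) (0 : Matrix m μ 𝕜)) (c • ((X⁻¹ * N)ᵀ * (X⁻¹ * N))))⁻¹ := by
  rw [inv_frame K Q D hX hXu N c hS, toBlocks_fromBlocks₁₁]

/-- [folklore] **STRUCTURAL FACT 1: `(𝔅⁻¹)_{(a⊕λ)(a⊕λ)} = 𝒦_R⁻¹` EXACTLY** (`𝒦_R := kkt (K + c•D(1 − M(MᵀM)⁻¹Mᵀ)Dᵀ) Q`, `M = X⁻¹N`; `X` symmetric, `c ≠ 0`,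
`det X`, `det(NᵀX⁻¹X⁻¹N)`, `det 𝒦_R` units) — the `(a, λ_Q)`-corner of the inverse of the LOCAL frame IS the inverse of the R-weighted bordered matrix;
no auxiliary field leaks into it. -/
theorem inv_frame_toBlocks₁₁_toBlocks₁₁ (K : Matrix ν ν 𝕜) (Q : Matrix μ ν 𝕜) (D : Matrix ν σ 𝕜) {X : Matrix σ σ 𝕜} (hX : Xᵀ = X)
    (hXu : IsUnit X.det) (N : Matrix σ m 𝕜) {c : 𝕜} (hc : c ≠ 0) (hG : IsUnit (Nᵀ * X⁻¹ * X⁻¹ * N).det)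
    (h𝒦 : IsUnit (kkt (K + c • (D * (1 - (X⁻¹ * N) * ((X⁻¹ * N)ᵀ * (X⁻¹ * N))⁻¹ * (X⁻¹ * N)ᵀ) * Dᵀ)) Q).det) :
    (((fromBlocks
        (fromBlocks (kkt (K + c • (D * Dᵀ)) Q) (0 : Matrix (ν ⊕ μ) m 𝕜) (0 : Matrix m (ν ⊕ μ) 𝕜) (0 : Matrix m m 𝕜))
        (fromCols (fromRows (fromRows (-(c • D)) (0 : Matrix μ σ 𝕜)) (0 : Matrix m σ 𝕜))
          (fromRows (fromRows (0 : Matrix ν σ 𝕜) (0 : Matrix μ σ 𝕜)) (-Nᵀ)))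
        (fromRows (fromRows (fromRows (-(c • D)) (0 : Matrix μ σ 𝕜)) (0 : Matrix m σ 𝕜))ᵀ
          (fromRows (fromRows (0 : Matrix ν σ 𝕜) (0 : Matrix μ σ 𝕜)) (-Nᵀ))ᵀ)
        (fromBlocks (c • (1 : Matrix σ σ 𝕜)) X X 0))⁻¹).toBlocks₁₁).toBlocks₁₁
      = (kkt (K + c • (D * (1 - (X⁻¹ * N) * ((X⁻¹ * N)ᵀ * (X⁻¹ * N))⁻¹ * (X⁻¹ * N)ᵀ) * Dᵀ)) Q)⁻¹ := by
  have hMt : (X⁻¹ * N)ᵀ = Nᵀ * X⁻¹ := by rw [transpose_mul, transpose_nonsing_inv, hX]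
  have hM : IsUnit ((X⁻¹ * N)ᵀ * (X⁻¹ * N)).det := by rw [hMt, ← Matrix.mul_assoc]; exact hG
  have hS : IsUnit (fromBlocks (kkt (K + c • (D * Dᵀ)) Q) (fromRows (-(c • (D * (X⁻¹ * N)))) (0 : Matrix μ m 𝕜))
      (fromCols (-(c • ((X⁻¹ * N)ᵀ * Dᵀ))) (0 : Matrix m μ 𝕜)) (c • ((X⁻¹ * N)ᵀ * (X⁻¹ * N)))).det := by
    rw [det_aug_eq_det_gram_mul_det_kkt K Q D (X⁻¹ * N) hc hM]
    refine IsUnit.mul ?_ h𝒦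
    rw [det_smul]; exact ((isUnit_iff_ne_zero.mpr hc).pow _).mul hM
  rw [inv_frame_toBlocks₁₁ K Q D hX hXu N c hS, inv_aug K Q D (X⁻¹ * N) hc hM h𝒦, toBlocks_fromBlocks₁₁]

/-- [folklore] Hence **`(𝔅⁻¹)_{aa} = (𝒦_R⁻¹)_{aa}`** (=: `Γ_R`, the R-weighted constrained propagator): the owner's structural numerics (kit j120171∕j120172,
`|(𝔅⁻¹)_{aa} − Γ_R|_max ≤ 1.5e-13`) are this exact identity. -/
theorem inv_frame_aa (K : Matrix ν ν 𝕜) (Q : Matrix μ ν 𝕜) (D : Matrix ν σ 𝕜) {X : Matrix σ σ 𝕜} (hX : Xᵀ = X)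
    (hXu : IsUnit X.det) (N : Matrix σ m 𝕜) {c : 𝕜} (hc : c ≠ 0) (hG : IsUnit (Nᵀ * X⁻¹ * X⁻¹ * N).det)
    (h𝒦 : IsUnit (kkt (K + c • (D * (1 - (X⁻¹ * N) * ((X⁻¹ * N)ᵀ * (X⁻¹ * N))⁻¹ * (X⁻¹ * N)ᵀ) * Dᵀ)) Q).det) :
    ((((fromBlocks
        (fromBlocks (kkt (K + c • (D * Dᵀ)) Q) (0 : Matrix (ν ⊕ μ) m 𝕜) (0 : Matrix m (ν ⊕ μ) 𝕜) (0 : Matrix m m 𝕜))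
        (fromCols (fromRows (fromRows (-(c • D)) (0 : Matrix μ σ 𝕜)) (0 : Matrix m σ 𝕜))
          (fromRows (fromRows (0 : Matrix ν σ 𝕜) (0 : Matrix μ σ 𝕜)) (-Nᵀ)))
        (fromRows (fromRows (fromRows (-(c • D)) (0 : Matrix μ σ 𝕜)) (0 : Matrix m σ 𝕜))ᵀ
          (fromRows (fromRows (0 : Matrix ν σ 𝕜) (0 : Matrix μ σ 𝕜)) (-Nᵀ))ᵀ)
        (fromBlocks (c • (1 : Matrix σ σ 𝕜)) X X 0))⁻¹).toBlocks₁₁).toBlocks₁₁).toBlocks₁₁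
      = ((kkt (K + c • (D * (1 - (X⁻¹ * N) * ((X⁻¹ * N)ᵀ * (X⁻¹ * N))⁻¹ * (X⁻¹ * N)ᵀ) * Dᵀ)) Q)⁻¹).toBlocks₁₁ := by
  rw [inv_frame_toBlocks₁₁_toBlocks₁₁ K Q D hX hXu N hc hG h𝒦]

/-- [folklore] **… and `(𝔅⁻¹)_{λλ} = (𝒦_R⁻¹)_{λλ} = −(Q·H_R⁻¹·Qᵀ)⁻¹`, `H_R := K + c•D(1 − M(MᵀM)⁻¹Mᵀ)Dᵀ`** (for `H_R` and `Q·H_R⁻¹·Qᵀ` nonsingular; the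
tree's `[A/P]`-block of the inverse, `Literature.LinearAlgebra.Matrix.toBlocks₂₂_inv_fromBlocks`) — the `λ_Q`-line of the frame is the coarse
constrained propagator (named for an3-g51's needle-row count, LETTER Λ-NULL v1.0.1 §5(b)). -/
theorem inv_frame_lamlam (K : Matrix ν ν 𝕜) (Q : Matrix μ ν 𝕜) (D : Matrix ν σ 𝕜) {X : Matrix σ σ 𝕜} (hX : Xᵀ = X)
    (hXu : IsUnit X.det) (N : Matrix σ m 𝕜) {c : 𝕜} (hc : c ≠ 0) (hG : IsUnit (Nᵀ * X⁻¹ * X⁻¹ * N).det)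
    (hH : IsUnit (K + c • (D * (1 - (X⁻¹ * N) * ((X⁻¹ * N)ᵀ * (X⁻¹ * N))⁻¹ * (X⁻¹ * N)ᵀ) * Dᵀ)).det)
    (hP : IsUnit (Q * (K + c • (D * (1 - (X⁻¹ * N) * ((X⁻¹ * N)ᵀ * (X⁻¹ * N))⁻¹ * (X⁻¹ * N)ᵀ) * Dᵀ))⁻¹ * Qᵀ).det) :
    ((((fromBlocks
        (fromBlocks (kkt (K + c • (D * Dᵀ)) Q) (0 : Matrix (ν ⊕ μ) m 𝕜) (0 : Matrix m (ν ⊕ μ) 𝕜) (0 : Matrix m m 𝕜))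
        (fromCols (fromRows (fromRows (-(c • D)) (0 : Matrix μ σ 𝕜)) (0 : Matrix m σ 𝕜))
          (fromRows (fromRows (0 : Matrix ν σ 𝕜) (0 : Matrix μ σ 𝕜)) (-Nᵀ)))
        (fromRows (fromRows (fromRows (-(c • D)) (0 : Matrix μ σ 𝕜)) (0 : Matrix m σ 𝕜))ᵀ
          (fromRows (fromRows (0 : Matrix ν σ 𝕜) (0 : Matrix μ σ 𝕜)) (-Nᵀ))ᵀ)
        (fromBlocks (c • (1 : Matrix σ σ 𝕜)) X X 0))⁻¹).toBlocks₁₁).toBlocks₁₁).toBlocks₂₂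
      = -(Q * (K + c • (D * (1 - (X⁻¹ * N) * ((X⁻¹ * N)ᵀ * (X⁻¹ * N))⁻¹ * (X⁻¹ * N)ᵀ) * Dᵀ))⁻¹ * Qᵀ)⁻¹ := by
  have h𝒦 : IsUnit (kkt (K + c • (D * (1 - (X⁻¹ * N) * ((X⁻¹ * N)ᵀ * (X⁻¹ * N))⁻¹ * (X⁻¹ * N)ᵀ) * Dᵀ)) Q).det :=
    isUnit_iff_ne_zero.mpr (det_kkt_ne_zero _ _ hH hP)
  have hS : IsUnit (Literature.LinearAlgebra.Matrix.schurCompl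
      (K + c • (D * (1 - (X⁻¹ * N) * ((X⁻¹ * N)ᵀ * (X⁻¹ * N))⁻¹ * (X⁻¹ * N)ᵀ) * Dᵀ)) Qᵀ Q (0 : Matrix μ μ 𝕜)).det := by
    rw [schurCompl_def, zero_sub, det_neg]
    exact ((isUnit_one.neg).pow _).mul hP
  rw [inv_frame_toBlocks₁₁_toBlocks₁₁ K Q D hX hXu N hc hG h𝒦]
  unfold kkt
  rw [toBlocks₂₂_inv_fromBlocks _ _ _ _ hH hS, schurCompl_def, zero_sub]
  exact Matrix.inv_eq_left_inv (by rw [neg_mul_neg, nonsing_inv_mul _ hP])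

/-- [folklore] **STRUCTURAL FACT 2: `(𝔅⁻¹)_{φφ} = (X⁻¹N)·(S⁻¹)_{ηη}·(NᵀX⁻¹)`** — since `(Z⁻¹)_{φφ} = 0` and the coupling `C` ties `φ` to `a` only, the `φφ` block
of `𝔅⁻¹` is mediated ENTIRELY by the block variable `η` (both legs carry `M = X⁻¹N`); `X` symmetric, `det X` and `det S` units. -/
theorem inv_frame_φφ (K : Matrix ν ν 𝕜) (Q : Matrix μ ν 𝕜) (D : Matrix ν σ 𝕜) {X : Matrix σ σ 𝕜} (hX : Xᵀ = X)
    (hXu : IsUnit X.det) (N : Matrix σ m 𝕜) (c : 𝕜)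
    (hS : IsUnit (fromBlocks (kkt (K + c • (D * Dᵀ)) Q) (fromRows (-(c • (D * (X⁻¹ * N)))) (0 : Matrix μ m 𝕜))
      (fromCols (-(c • ((X⁻¹ * N)ᵀ * Dᵀ))) (0 : Matrix m μ 𝕜)) (c • ((X⁻¹ * N)ᵀ * (X⁻¹ * N)))).det) :
    (((fromBlocks
        (fromBlocks (kkt (K + c • (D * Dᵀ)) Q) (0 : Matrix (ν ⊕ μ) m 𝕜) (0 : Matrix m (ν ⊕ μ) 𝕜) (0 : Matrix m m 𝕜))
        (fromCols (fromRows (fromRows (-(c • D)) (0 : Matrix μ σ 𝕜)) (0 : Matrix m σ 𝕜))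
          (fromRows (fromRows (0 : Matrix ν σ 𝕜) (0 : Matrix μ σ 𝕜)) (-Nᵀ)))
        (fromRows (fromRows (fromRows (-(c • D)) (0 : Matrix μ σ 𝕜)) (0 : Matrix m σ 𝕜))ᵀ
          (fromRows (fromRows (0 : Matrix ν σ 𝕜) (0 : Matrix μ σ 𝕜)) (-Nᵀ))ᵀ)
        (fromBlocks (c • (1 : Matrix σ σ 𝕜)) X X 0))⁻¹).toBlocks₂₂).toBlocks₁₁
      = (X⁻¹ * N)
          * ((fromBlocks (kkt (K + c • (D * Dᵀ)) Q) (fromRows (-(c • (D * (X⁻¹ * N)))) (0 : Matrix μ m 𝕜))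
              (fromCols (-(c • ((X⁻¹ * N)ᵀ * Dᵀ))) (0 : Matrix m μ 𝕜)) (c • ((X⁻¹ * N)ᵀ * (X⁻¹ * N))))⁻¹).toBlocks₂₂
          * (Nᵀ * X⁻¹) := by
  rw [inv_frame K Q D hX hXu N c hS, toBlocks_fromBlocks₂₂]
  generalize (fromBlocks (kkt (K + c • (D * Dᵀ)) Q) (fromRows (-(c • (D * (X⁻¹ * N)))) (0 : Matrix μ m 𝕜))
      (fromCols (-(c • ((X⁻¹ * N)ᵀ * Dᵀ))) (0 : Matrix m μ 𝕜)) (c • ((X⁻¹ * N)ᵀ * (X⁻¹ * N))))⁻¹ = Si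
  rw [← fromBlocks_toBlocks Si]
  simp only [fromBlocks_multiply, fromBlocks_add, toBlocks_fromBlocks₁₁, toBlocks_fromBlocks₂₂, Matrix.zero_mul, Matrix.mul_zero,
    zero_add, Matrix.neg_mul, Matrix.mul_neg, neg_neg, Matrix.mul_assoc]

/-- [folklore] **… and `(𝔅⁻¹)_{(a⊕λ),φ} = (S⁻¹)_{(a⊕λ),η}·(NᵀX⁻¹)`** — the field–`φ` block is mediated by `η` too; with `inv_aug`,
`(S⁻¹)_{(a⊕λ),η}·Mᵀ = 𝒦_R⁻¹·[D·M(MᵀM)⁻¹Mᵀ; 0]`, i.e. the field reaches `φ` only through the projector onto `range M` (`M = X⁻¹N = G′_UQ′ᵀ`). -/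
theorem inv_frame_aφ (K : Matrix ν ν 𝕜) (Q : Matrix μ ν 𝕜) (D : Matrix ν σ 𝕜) {X : Matrix σ σ 𝕜} (hX : Xᵀ = X)
    (hXu : IsUnit X.det) (N : Matrix σ m 𝕜) (c : 𝕜)
    (hS : IsUnit (fromBlocks (kkt (K + c • (D * Dᵀ)) Q) (fromRows (-(c • (D * (X⁻¹ * N)))) (0 : Matrix μ m 𝕜))
      (fromCols (-(c • ((X⁻¹ * N)ᵀ * Dᵀ))) (0 : Matrix m μ 𝕜)) (c • ((X⁻¹ * N)ᵀ * (X⁻¹ * N)))).det) :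
    (((fromBlocks
        (fromBlocks (kkt (K + c • (D * Dᵀ)) Q) (0 : Matrix (ν ⊕ μ) m 𝕜) (0 : Matrix m (ν ⊕ μ) 𝕜) (0 : Matrix m m 𝕜))
        (fromCols (fromRows (fromRows (-(c • D)) (0 : Matrix μ σ 𝕜)) (0 : Matrix m σ 𝕜))
          (fromRows (fromRows (0 : Matrix ν σ 𝕜) (0 : Matrix μ σ 𝕜)) (-Nᵀ)))
        (fromRows (fromRows (fromRows (-(c • D)) (0 : Matrix μ σ 𝕜)) (0 : Matrix m σ 𝕜))ᵀ
          (fromRows (fromRows (0 : Matrix ν σ 𝕜) (0 : Matrix μ σ 𝕜)) (-Nᵀ))ᵀ)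
        (fromBlocks (c • (1 : Matrix σ σ 𝕜)) X X 0))⁻¹).toBlocks₁₂).toBlocks₁₁
      = ((fromBlocks (kkt (K + c • (D * Dᵀ)) Q) (fromRows (-(c • (D * (X⁻¹ * N)))) (0 : Matrix μ m 𝕜))
              (fromCols (-(c • ((X⁻¹ * N)ᵀ * Dᵀ))) (0 : Matrix m μ 𝕜)) (c • ((X⁻¹ * N)ᵀ * (X⁻¹ * N))))⁻¹).toBlocks₁₂
          * (Nᵀ * X⁻¹) := by
  rw [inv_frame K Q D hX hXu N c hS, toBlocks_fromBlocks₁₂]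
  generalize (fromBlocks (kkt (K + c • (D * Dᵀ)) Q) (fromRows (-(c • (D * (X⁻¹ * N)))) (0 : Matrix μ m 𝕜))
      (fromCols (-(c • ((X⁻¹ * N)ᵀ * Dᵀ))) (0 : Matrix m μ 𝕜)) (c • ((X⁻¹ * N)ᵀ * (X⁻¹ * N))))⁻¹ = Si
  rw [← fromBlocks_toBlocks Si]
  simp only [fromBlocks_multiply, fromBlocks_neg, toBlocks_fromBlocks₁₁, toBlocks_fromBlocks₁₂, Matrix.mul_zero, zero_add,
    Matrix.mul_neg, neg_neg]

end Frame

end Field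

end Summit.QuantumFields.BalabanUV.Beta.D1BFx.LocalisedFrameInverse
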